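import Summits.QuantumAdvantage.QuantumAdvantage.Theorems.AnchorDialPlaceM

/-!
# AnchorDial — part 27 «FinalM» (cell decomp-qadv, seat lens-2, generation 15; supports item 26531 `ExactnessDial.PolyLossOddU3`)

§J of the g15 node «GaugeDial», re-namespaced to `…Theorems.AnchorDial`: the MULTI-ANCHOR LOSS LAW and the node
collapse.  `multiAnchor_loss_pos` / `multiAnchor_loss m r c : ∃ n₀, ∀ n ≥ n₀, ∀ P, deg ≤ (log₂ n)^c → MAnchorable m r c P
→ 2^{n-1} ≤ 2^{4m+14}·#{odd losers}` (`F = 4m+8` flip sites in one region of length `≈ F√n`, averaged over `n/2`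
offsets; all thresholds absorbed by `log₂ n`), **`multiAnchorLoss3 : MultiAnchorLoss3`** (exponent `C = 1`), the
collapse `polyLossOddU3_iff_noMultiAnchorLoss3 : T ⟺ NoMultiAnchorLoss3` and
`closes_noMultiAnchor : NoMultiAnchorLoss3 → DPLift3 → AdviceFreeQNC0Three` BY NAME (via `HolonomyDial.closes_T`).
Namespace `…Theorems.AnchorDial`; imports part 26 (and through it parts 19–25).  Verbatim from the node file §J up to
the namespace; no `sorry`, no `native_decide`, no instances/notation; lint-clean without the unusedVariables switch.  Axioms of `multiAnchorLoss3` / `closes_noMultiAnchor`: `propext, Classical.choice, Quot.sound`.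
-/

set_option linter.dupNamespace false

/-! ## §J  THE LAW FOR EVERY `m`: `MultiAnchorLoss3` PROVED; node collapse `T ⟺ NoMultiAnchorLoss3` -/

noncomputable section

open scoped Classical

namespace Summit.QuantumAdvantage.QuantumAdvantage.Theorems.AnchorDial

open Finset
open Literature.Computability.QuantumComplexity Literature.Computability.QuantumComplexity.RingHLF
open Literature.Computability.MetaComplexity Literature.Computability.MetaComplexity.Smolensky
open Summit.QuantumAdvantage.AdviceFreeQNC0
open Summit.QuantumAdvantage.QuantumAdvantage.Theses (ExactnessDial.PolyLossOddU3 ExactnessDial.DPLift3)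
open Summit.QuantumAdvantage.QuantumAdvantage.Theorems.HolonomyDial (closes_T card_odd_le gCond selP selP_mem selP_apply indP indP_mem indP_apply)

variable {N : ℕ}

section FinalM

/-- **the multi-anchor loss law, `m ≥ 1`** (constant loss `≥ 2^{-(4m+10)}` of the odd class, eventually in `n`):
`F = 4m+8` flip sites in one region of length `≈ F√n`, averaged over `n/2` offsets; thresholds `log₂ n`. -/
theorem multiAnchor_loss_pos (m r c : ℕ) (hm : 0 < m) : ∃ n₀ : ℕ, ∀ n ≥ n₀, ∀ P : Fin n → CubeFn (ZMod 3) n,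
    (∀ i, P i ∈ lowDeg (ZMod 3) n ((Nat.log 2 n) ^ c)) → MAnchorable m r c P →
      2 ^ (n - 1) ≤ 2 ^ (4 * m + 10) * (univ.filter fun x : Fin n → Bool =>
        OddZeros x ∧ ¬ Rel x (fun i => decide (P i x = 1))).card := by
  -- constants (functions of `m, r, c` only), made opaque
  obtain ⟨n₁, hn₁⟩ := TubePlanProof.logPow_le_natSqrt (2 * c + 1)
  set F := 4 * m + 8 with hFdef
  have hcore' : 4 * (6 ^ m * (1 + F + F.choose 2)) ≤ 2 ^ F := hcore m
  clear_value F
  have hF4 : 4 ≤ F := by omega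
  set CM := 6 ^ m * (1 + F + F.choose 2) with hCM
  set e := F + 1 + 2 * (2 ^ F * 6 ^ m) with hedef
  clear_value e
  set cT := 2 * m + m * (r + 1) * 4 + m * r with hcT
  clear_value cT
  set G1 := 2 ^ (e + 2) * (6 ^ m * (2 ^ F * (4 * cT))) with hG1
  clear_value G1
  set X := 2 ^ F * (F + 1) * (m + 1) with hX
  have hX1 : m + 1 ≤ X := Nat.le_mul_of_pos_left _ (by positivity)
  have hX2 : 2 ^ F ≤ X := by
    rw [hX, mul_assoc]; exact Nat.le_mul_of_pos_right _ (by positivity)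
  have hX3 : 2 ^ F * F * m ≤ X :=
    Nat.mul_le_mul (Nat.mul_le_mul_left _ (Nat.le_succ F)) (Nat.le_succ m)
  clear_value X
  set Λ := 64 * X with hΛ
  clear_value Λ
  set S0 := 128 * ((m + 1) * (F + 1)) + r + 8 with hS0
  clear_value S0
  refine ⟨max n₁ (max (2 ^ (Λ + G1 * G1)) (S0 * S0 + e + 8)), fun N hN P hP hM => ?_⟩
  have hNn₁ : n₁ ≤ N := le_trans (le_max_left _ _) hN
  have hNpow : 2 ^ (Λ + G1 * G1) ≤ N := le_trans (le_trans (le_max_left _ _) (le_max_right _ _)) hN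
  have hNS0 : S0 * S0 + e + 8 ≤ N := le_trans (le_trans (le_max_right _ _) (le_max_right _ _)) hN
  obtain ⟨A, hA, hU, hS, hNN⟩ := hM
  have hls := hn₁ N hNn₁
  have hss : Nat.sqrt N * Nat.sqrt N ≤ N := Nat.sqrt_le N
  have hsge : S0 ≤ Nat.sqrt N :=
    Nat.le_sqrt.2 (le_trans (le_trans (Nat.le_add_right _ _) (Nat.le_add_right _ _)) hNS0)
  have hℓge : Λ + G1 * G1 ≤ Nat.log 2 N := Nat.le_log_of_pow_le (by norm_num) hNpow
  set ℓ := Nat.log 2 N with hℓ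
  clear_value ℓ
  set s := Nat.sqrt N with hs
  clear_value s
  have hℓpos : 0 < ℓ := by omega
  have h16m : 16 * m ≤ ℓ := by omega
  have h16F : 16 * 2 ^ F ≤ ℓ := by omega
  have hc64 : 64 * (2 ^ F * F * m) ≤ ℓ := by omega
  have hG1ℓ : G1 * G1 ≤ ℓ := by omega
  have hs1 : 1 ≤ s := by omega
  have h128 : 128 * ((m + 1) * (F + 1)) ≤ s := by omega
  set L := 2 * s + 1 with hL
  clear_value L
  have hLodd : Odd L := ⟨s, by omega⟩
  have hrL : r ≤ L := by omega
  set Lt := N / 2 with hLt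
  clear_value Lt
  have hLtpos : 0 < Lt := by omega
  set D := ℓ ^ c with hD
  have hD1 : 1 ≤ D := by rw [hD]; exact Nat.one_le_pow _ _ hℓpos
  clear_value D
  set DT := m * (D + D) + (m * (r + 1) * ((D + D) + 2) + m * r) with hDT
  set D' := 6 ^ m * (2 ^ F * (DT + DT)) with hD'
  have j₀ : Fin m := ⟨0, hm⟩
  -- the degree budget `2^(e+2)·2D'·C(L, L/2) ≤ 2^L`
  have hDTle : DT ≤ cT * D := by
    have t0 : m * (D + D) = 2 * (m * D) := by ring
    have t1 : (D + D) + 2 ≤ 4 * D := by omega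
    have t2 : m * (r + 1) * ((D + D) + 2) ≤ m * (r + 1) * (4 * D) := Nat.mul_le_mul_left _ t1
    have t3 : m * r ≤ m * r * D := Nat.le_mul_of_pos_right _ hD1
    have t4 : cT * D = 2 * (m * D) + m * (r + 1) * (4 * D) + m * r * D := by rw [hcT]; ring
    omega
  have hKD : 2 ^ (e + 2) * (D' + D') ≤ G1 * D := by
    have t5 : D' + D' ≤ (6 ^ m * (2 ^ F * (4 * cT))) * D := by
      calc D' + D' = 6 ^ m * (2 ^ F * ((DT + DT) + (DT + DT))) := by rw [hD']; ring
        _ ≤ 6 ^ m * (2 ^ F * (4 * (cT * D))) := by gcongr; omega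
        _ = _ := by ring
    calc 2 ^ (e + 2) * (D' + D') ≤ 2 ^ (e + 2) * ((6 ^ m * (2 ^ F * (4 * cT))) * D) := Nat.mul_le_mul_left _ t5
      _ = G1 * D := by rw [hG1]; ring
  have hK : 2 ^ (e + 2) * ((D' + D') * L.choose (L / 2)) ≤ 2 ^ L := by
    refine hK_gen hLodd ?_
    calc (2 ^ (e + 2) * (D' + D')) ^ 2 ≤ (G1 * D) ^ 2 := Nat.pow_le_pow_left hKD 2
      _ = G1 * G1 * (D * D) := by ring
      _ ≤ ℓ * (D * D) := Nat.mul_le_mul_right _ hG1ℓ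
      _ = ℓ ^ (2 * c + 1) := by rw [hD]; ring
      _ ≤ s := hls
      _ ≤ L := by omega
  -- fit of the region `[t+L, t+FL+1]`, `t < N/2`
  have hl1 : F + 1 ≤ (m + 1) * (F + 1) := Nat.le_mul_of_pos_left _ (by omega)
  have hfitall : Lt + (F + 1) * L + 1 ≤ N := by
    have b0 : (F + 1) * L = 2 * ((F + 1) * s) + (F + 1) := by rw [hL]; ring
    have b1 : F + 1 ≤ (F + 1) * s := Nat.le_mul_of_pos_right _ hs1
    have b2 : 8 * ((F + 1) * s) ≤ s * s := by
      calc 8 * ((F + 1) * s) = (8 * (F + 1)) * s := by ring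
        _ ≤ s * s := Nat.mul_le_mul_right _ (by omega)
    omega
  have hFL : F * L + L = (F + 1) * L := by ring
  -- the per-offset counting shell
  have hshell : ∀ t < Lt, 2 ^ (F + 1) * (univ.filter fun x : Fin N → Bool => OddZeros x).card ≤
      CM * 2 ^ N
      + 2 ^ (F + 1) * CM * Fintype.card ((Fin m → ZMod 3 × Bool) → (Fin F → Bool) → ZMod 3) * 2 ^ (N - e)
      + 2 ^ (F + 1) * (2 ^ F * (univ.filter fun y : Fin N → Bool => OddZeros y ∧ ¬ Rel y (outB P y)).card
          + ∑ j, (univ.filter fun x : Fin N → Bool =>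
              OddZeros x ∧ (univ.filter fun k : Fin N => A j k x = 1).card ≠ 1).card
          + 2 ^ F * ∑ j, ∑ i, (univ.filter fun y : Fin N → Bool => OddZeros y ∧ UBP (A j) (siteF t L F i) y).card
          + ∑ j, (univ.filter fun x : Fin N → Bool => OddZeros x ∧
              ∃ k, anc (A j) x = {k} ∧ ¬ ((∀ i, k.val + r < siteF t L F i) ∨ (∀ i, siteF t L F i + 1 ≤ k.val))).card
          + 2 ^ F * (univ.filter fun y : Fin N → Bool => OddZeros y ∧
              ¬ ∃ kv : Fin m → Fin N, (∀ j, A j (kv j) y = 1) ∧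
                ∀ q ∈ dev P y, ∃ j, (kv j).val ≤ q.val ∧ q.val ≤ (kv j).val + r).card) := by
    intro t ht
    have hfit : t + 1 + (F + 1) * L ≤ N := by omega
    have hb : ∀ i j : Fin F, i < j → siteF t L F i + 2 ≤ siteF t L F j := by
      intro i j hij
      show t + (i.val + 1) * L + 2 ≤ t + (j.val + 1) * L
      have h1 : (i.val + 2) * L ≤ (j.val + 1) * L := Nat.mul_le_mul_right L (by omega)
      have h2 : (i.val + 2) * L = (i.val + 1) * L + L := by ring
      omega
    have hbN : ∀ i : Fin F, siteF t L F i + 3 ≤ N := by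
      intro i
      show t + (i.val + 1) * L + 3 ≤ N
      have h1 : (i.val + 2) * L ≤ (F + 1) * L := Nat.mul_le_mul_right L (by omega)
      have h2 : (i.val + 2) * L = (i.val + 1) * L + L := by ring
      omega
    have hEq := equiF_gen (N := N) (F := F) (D' := D') hLodd (by omega) hfit (by omega) hK
    have hT : ∀ g ε, TU P A r (siteF t L F) j₀ g ε ∈ lowDeg (ZMod 3) N DT :=
      fun g ε => TU_mem hP hA r _ j₀ g ε
    refine count_shellM (by omega) hF4 j₀ P A r hb hbN (2 ^ (N - e)) (fun δ z₀ => ?_)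
    have hE := hEq (classM P A r (siteF t L F) j₀ δ) (classM_mem hT δ) z₀
    have e1 : (univ.filter fun x : Fin N → Bool =>
        OddZeros x ∧ classM P A r (siteF t L F) j₀ δ x = 1 ∧ zvecF (siteF t L F) x = z₀) =
        univ.filter fun x : Fin N → Bool =>
          OddZeros x ∧ datM P A r (siteF t L F) j₀ x = δ ∧ zvecF (siteF t L F) x = z₀ := by
      refine filter_congr fun x _ => ?_
      rw [classM_apply]
      by_cases h : datM P A r (siteF t L F) j₀ x = δ <;> simp [h]
    have e2 : (univ.filter fun x : Fin N → Bool => classM P A r (siteF t L F) j₀ δ x = 1) =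
        univ.filter fun x : Fin N → Bool => datM P A r (siteF t L F) j₀ x = δ := by
      refine filter_congr fun x _ => ?_
      rw [classM_apply]
      by_cases h : datM P A r (siteF t L F) j₀ x = δ <;> simp [h]
    rw [e1, e2] at hE
    exact hE
  -- (STAB) in `UBP` form
  have hSU : ∀ j a, (univ.filter fun y : Fin N → Bool => OddZeros y ∧ UBP (A j) a y).card =
      (univ.filter fun x : Fin N → Bool =>
        OddZeros x ∧ ∃ k : Fin N, ¬ ((A j k (flip2 a (a + 1) x) = 1) ↔ (A j k x = 1))).card :=
    fun j a => congrArg Finset.card (filter_congr fun y _ => Iff.rfl)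
  -- placement: an offset `t < N/2` carrying at most the average instability and straddle mass
  have hsum : ∑ t ∈ range Lt,
      (2 ^ F * ∑ j, ∑ i, (univ.filter fun y : Fin N → Bool => OddZeros y ∧ UBP (A j) (siteF t L F i) y).card
        + ∑ j, (univ.filter fun x : Fin N → Bool => OddZeros x ∧
            ∃ k, anc (A j) x = {k} ∧ ¬ ((∀ i, k.val + r < siteF t L F i) ∨ (∀ i, siteF t L F i + 1 ≤ k.val))).card)
      ≤ 2 ^ F * ∑ j : Fin m, ∑ i : Fin F, ∑ a ∈ range N,
            (univ.filter fun y : Fin N → Bool => OddZeros y ∧ UBP (A j) a y).card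
        + ∑ j : Fin m, (F * L + 1) * (univ.filter fun x : Fin N → Bool => OddZeros x).card := by
    rw [sum_add_distrib, ← mul_sum]
    refine Nat.add_le_add (Nat.mul_le_mul_left _ (sum_inst_le
      (fun j a => (univ.filter fun y : Fin N → Bool => OddZeros y ∧ UBP (A j) a y).card) Lt L N (by omega))) ?_
    rw [Finset.sum_comm]
    refine sum_le_sum fun j _ => ?_
    exact le_trans (sum_le_sum fun t _ => card_straddle_le (F := F) (A j) t L r hrL)
      (sum_straddle_le (A j) Lt (F * L + 1) (by omega))
  obtain ⟨t, ht, hplace⟩ := exists_mul_le_of_sum_le Lt hLtpos _ _ hsum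
  have hsh := hshell t ht
  -- name the masses
  have hE0 : Fintype.card ((Fin m → ZMod 3 × Bool) → (Fin F → Bool) → ZMod 3) = 3 ^ (2 ^ F * 6 ^ m) := by
    rw [Fintype.card_fun, card_gauge, Fintype.card_fun, ZMod.card, Fintype.card_fun, Fintype.card_bool,
      Fintype.card_fin, ← pow_mul]
  rw [hE0] at hsh
  set O := (univ.filter fun x : Fin N → Bool => OddZeros x).card with hO
  set LOSE := (univ.filter fun y : Fin N → Bool => OddZeros y ∧ ¬ Rel y (outB P y)).card with hLOSE
  set UNI := ∑ j, (univ.filter fun x : Fin N → Bool =>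
    OddZeros x ∧ (univ.filter fun k : Fin N => A j k x = 1).card ≠ 1).card with hUNI
  set IT := ∑ j, ∑ i, (univ.filter fun y : Fin N → Bool => OddZeros y ∧ UBP (A j) (siteF t L F i) y).card with hIT
  set ST := ∑ j, (univ.filter fun x : Fin N → Bool => OddZeros x ∧
    ∃ k, anc (A j) x = {k} ∧ ¬ ((∀ i, k.val + r < siteF t L F i) ∨ (∀ i, siteF t L F i + 1 ≤ k.val))).card with hST
  set NNc := (univ.filter fun y : Fin N → Bool => OddZeros y ∧
    ¬ ∃ kv : Fin m → Fin N, (∀ j, A j (kv j) y = 1) ∧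
      ∀ q ∈ dev P y, ∃ j, (kv j).val ≤ q.val ∧ q.val ≤ (kv j).val + r).card with hNNc
  set SUtot := ∑ j : Fin m, ∑ i : Fin F, ∑ a ∈ range N,
    (univ.filter fun y : Fin N → Bool => OddZeros y ∧ UBP (A j) a y).card with hSUtot
  -- the facts
  have hP1 : 2 ^ (N - 1) = 2 * 2 ^ (N - 2) := by rw [← pow_succ']; congr 1; omega
  have hP0 : 2 ^ N = 4 * 2 ^ (N - 2) := by
    rw [show (4 : ℕ) = 2 ^ 2 by norm_num, ← pow_add]; congr 1; omega
  have f4 : 2 ^ (N - 1) ≤ O := card_odd_ge (by omega)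
  have f9 : O ≤ 2 ^ (N - 1) := card_odd_le (by omega)
  have hWE : 2 ^ (F + 1) * 3 ^ (2 ^ F * 6 ^ m) ≤ 2 ^ e := by
    calc 2 ^ (F + 1) * 3 ^ (2 ^ F * 6 ^ m) ≤ 2 ^ (F + 1) * 4 ^ (2 ^ F * 6 ^ m) :=
          Nat.mul_le_mul_left _ (Nat.pow_le_pow_left (by norm_num) _)
      _ = 2 ^ e := by rw [hedef, show (4 : ℕ) = 2 ^ 2 by norm_num, ← pow_mul, ← pow_add]
  have f2 : 2 ^ (F + 1) * CM * 3 ^ (2 ^ F * 6 ^ m) * 2 ^ (N - e) ≤ CM * 2 ^ N := by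
    calc 2 ^ (F + 1) * CM * 3 ^ (2 ^ F * 6 ^ m) * 2 ^ (N - e)
        = CM * ((2 ^ (F + 1) * 3 ^ (2 ^ F * 6 ^ m)) * 2 ^ (N - e)) := by ring
      _ ≤ CM * (2 ^ e * 2 ^ (N - e)) := Nat.mul_le_mul_left _ (Nat.mul_le_mul_right _ hWE)
      _ = CM * 2 ^ N := by rw [← pow_add]; congr 2; omega
  have f3 : 8 * CM ≤ 2 ^ (F + 1) := by rw [pow_succ]; omega
  have f5 : ℓ * UNI ≤ m * 2 ^ (N - 1) := by
    rw [hUNI, mul_sum]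
    calc ∑ j, ℓ * (univ.filter fun x : Fin N → Bool =>
          OddZeros x ∧ (univ.filter fun k : Fin N => A j k x = 1).card ≠ 1).card
        ≤ ∑ j : Fin m, 2 ^ (N - 1) := sum_le_sum fun j _ => hU j
      _ = m * 2 ^ (N - 1) := by rw [sum_const, smul_eq_mul, card_univ, Fintype.card_fin]
  have f6 : ℓ * NNc ≤ 2 ^ (N - 1) := hNN
  have f8 : ℓ * SUtot ≤ m * (F * (N * 2 ^ (N - 1))) := by
    rw [hSUtot, mul_sum]
    calc ∑ j, ℓ * ∑ i : Fin F, ∑ a ∈ range N, (univ.filter fun y : Fin N → Bool => OddZeros y ∧ UBP (A j) a y).card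
        ≤ ∑ j : Fin m, F * (N * 2 ^ (N - 1)) := sum_le_sum fun j _ => by
          rw [mul_sum]
          calc ∑ i : Fin F, ℓ * ∑ a ∈ range N, (univ.filter fun y : Fin N → Bool => OddZeros y ∧ UBP (A j) a y).card
              ≤ ∑ i : Fin F, N * 2 ^ (N - 1) := sum_le_sum fun i _ => by
                rw [sum_congr rfl fun a _ => hSU j a]; exact hS j
            _ = F * (N * 2 ^ (N - 1)) := by rw [sum_const, smul_eq_mul, card_univ, Fintype.card_fin]
      _ = m * (F * (N * 2 ^ (N - 1))) := by rw [sum_const, smul_eq_mul, card_univ, Fintype.card_fin]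
  have f7 : Lt * (2 ^ F * IT + ST) ≤ 2 ^ F * SUtot + m * ((F * L + 1) * O) := by
    have h := hplace
    rw [sum_const, card_univ, Fintype.card_fin, smul_eq_mul] at h
    exact h
  -- (I1): `2^{N-2} ≤ 2^F·LOSE + J`
  have g0 : CM * 2 ^ N + 2 ^ (F + 1) * CM * 3 ^ (2 ^ F * 6 ^ m) * 2 ^ (N - e) ≤ 2 ^ (F + 1) * 2 ^ (N - 2) := by
    calc CM * 2 ^ N + 2 ^ (F + 1) * CM * 3 ^ (2 ^ F * 6 ^ m) * 2 ^ (N - e)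
        ≤ CM * 2 ^ N + CM * 2 ^ N := Nat.add_le_add_left f2 _
      _ = (8 * CM) * 2 ^ (N - 2) := by rw [hP0]; ring
      _ ≤ 2 ^ (F + 1) * 2 ^ (N - 2) := Nat.mul_le_mul_right _ f3
  have g1 : 2 ^ (F + 1) * O ≤ 2 ^ (F + 1) * (2 ^ (N - 2) + (2 ^ F * LOSE + UNI + 2 ^ F * IT + ST + 2 ^ F * NNc)) := by
    rw [Nat.mul_add]; omega
  have g2 : O ≤ 2 ^ (N - 2) + (2 ^ F * LOSE + UNI + 2 ^ F * IT + ST + 2 ^ F * NNc) :=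
    Nat.le_of_mul_le_mul_left g1 (by positivity)
  have I1 : 2 ^ (N - 2) ≤ 2 ^ F * LOSE + (UNI + 2 ^ F * IT + ST + 2 ^ F * NNc) := by omega
  -- the junk `J = UNI + 2^F·IT + ST + 2^F·NN` is at most half of `2^{N-2}`
  have u1 : ℓ * UNI ≤ m * (2 * 2 ^ (N - 2)) := by rw [← hP1]; exact f5
  have u2 : ℓ * NNc ≤ 2 * 2 ^ (N - 2) := by rw [← hP1]; exact f6
  have u3 : ℓ * (Lt * (2 ^ F * IT + ST)) ≤
      2 ^ F * (m * (F * (N * (2 * 2 ^ (N - 2))))) + ℓ * (m * ((F * L + 1) * (2 * 2 ^ (N - 2)))) := by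
    rw [← hP1]
    calc ℓ * (Lt * (2 ^ F * IT + ST)) ≤ ℓ * (2 ^ F * SUtot + m * ((F * L + 1) * O)) := Nat.mul_le_mul_left _ f7
      _ = 2 ^ F * (ℓ * SUtot) + ℓ * (m * ((F * L + 1) * O)) := by ring
      _ ≤ 2 ^ F * (m * (F * (N * 2 ^ (N - 1)))) + ℓ * (m * ((F * L + 1) * 2 ^ (N - 1))) :=
          Nat.add_le_add (Nat.mul_le_mul_left _ f8)
            (Nat.mul_le_mul_left _ (Nat.mul_le_mul_left _ (Nat.mul_le_mul_left _ f9)))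
  have u : ℓ * Lt * (2 * (UNI + 2 ^ F * IT + ST + 2 ^ F * NNc)) ≤
      (4 * (Lt * m) + 4 * (2 ^ F * F * m * N) + 4 * (ℓ * (m * (F * L + 1))) + 4 * (2 ^ F * Lt)) * 2 ^ (N - 2) := by
    calc ℓ * Lt * (2 * (UNI + 2 ^ F * IT + ST + 2 ^ F * NNc))
        = 2 * (Lt * (ℓ * UNI)) + 2 * (ℓ * (Lt * (2 ^ F * IT + ST))) + 2 * ((2 ^ F * Lt) * (ℓ * NNc)) := by ring
      _ ≤ 2 * (Lt * (m * (2 * 2 ^ (N - 2))))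
          + 2 * (2 ^ F * (m * (F * (N * (2 * 2 ^ (N - 2))))) + ℓ * (m * ((F * L + 1) * (2 * 2 ^ (N - 2)))))
          + 2 * ((2 ^ F * Lt) * (2 * 2 ^ (N - 2))) :=
          Nat.add_le_add (Nat.add_le_add (Nat.mul_le_mul_left _ (Nat.mul_le_mul_left _ u1))
            (Nat.mul_le_mul_left _ u3)) (Nat.mul_le_mul_left _ (Nat.mul_le_mul_left _ u2))
      _ = _ := by ring
  have Ta : 16 * (Lt * m) ≤ ℓ * Lt := by
    calc 16 * (Lt * m) = (16 * m) * Lt := by ring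
      _ ≤ ℓ * Lt := Nat.mul_le_mul_right _ h16m
  have Tb : 16 * (2 ^ F * Lt) ≤ ℓ * Lt := by
    calc 16 * (2 ^ F * Lt) = (16 * 2 ^ F) * Lt := by ring
      _ ≤ ℓ * Lt := Nat.mul_le_mul_right _ h16F
  have Tc : 16 * (2 ^ F * F * m * N) ≤ ℓ * Lt := by
    have hN4 : N ≤ 4 * Lt := by omega
    calc 16 * (2 ^ F * F * m * N) ≤ 16 * (2 ^ F * F * m * (4 * Lt)) := by gcongr
      _ = (64 * (2 ^ F * F * m)) * Lt := by ring
      _ ≤ ℓ * Lt := Nat.mul_le_mul_right _ hc64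
  have Td : 16 * (ℓ * (m * (F * L + 1))) ≤ ℓ * Lt := by
    have hd : 32 * (m * (F * L + 1)) ≤ N := by
      have i1 : m * F ≤ m * F * s := Nat.le_mul_of_pos_right _ hs1
      have i2 : m ≤ m * s := Nat.le_mul_of_pos_right _ hs1
      have e1 : m * (F * L + 1) = 2 * (m * F * s) + m * F + m := by rw [hL]; ring
      have e2 : (m + 1) * (F + 1) * s = m * F * s + m * s + F * s + s := by ring
      have i3 : 128 * ((m + 1) * (F + 1) * s) ≤ s * s := by
        calc 128 * ((m + 1) * (F + 1) * s) = (128 * ((m + 1) * (F + 1))) * s := by ring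
          _ ≤ s * s := Nat.mul_le_mul_right _ h128
      omega
    calc 16 * (ℓ * (m * (F * L + 1))) = ℓ * (16 * (m * (F * L + 1))) := by ring
      _ ≤ ℓ * Lt := Nat.mul_le_mul_left _ (by omega)
  have star : 4 * (Lt * m) + 4 * (2 ^ F * F * m * N) + 4 * (ℓ * (m * (F * L + 1))) + 4 * (2 ^ F * Lt) ≤ ℓ * Lt := by
    omega
  have hQ : ℓ * Lt * (2 * (UNI + 2 ^ F * IT + ST + 2 ^ F * NNc)) ≤ (ℓ * Lt) * 2 ^ (N - 2) :=
    u.trans (Nat.mul_le_mul_right _ star)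
  have claim : 2 * (UNI + 2 ^ F * IT + ST + 2 ^ F * NNc) ≤ 2 ^ (N - 2) :=
    Nat.le_of_mul_le_mul_left hQ (Nat.mul_pos hℓpos hLtpos)
  -- conclusion
  have hfin : 2 ^ (N - 1) ≤ 2 ^ (F + 2) * LOSE := by
    rw [hP1, pow_add, show (2 : ℕ) ^ 2 = 4 by norm_num]
    have : 2 ^ F * 4 * LOSE = 4 * (2 ^ F * LOSE) := by ring
    omega
  rw [show 4 * m + 10 = F + 2 by omega]
  exact hfin

/-- **the multi-anchor loss law for every `m`** (`m = 0` through `MAnchorable 0 → MAnchorable 1`). -/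
theorem multiAnchor_loss (m r c : ℕ) : ∃ n₀ : ℕ, ∀ n ≥ n₀, ∀ P : Fin n → CubeFn (ZMod 3) n,
    (∀ i, P i ∈ lowDeg (ZMod 3) n ((Nat.log 2 n) ^ c)) → MAnchorable m r c P →
      2 ^ (n - 1) ≤ 2 ^ (4 * m + 14) * (univ.filter fun x : Fin n → Bool =>
        OddZeros x ∧ ¬ Rel x (fun i => decide (P i x = 1))).card := by
  rcases Nat.eq_zero_or_pos m with rfl | hm
  · obtain ⟨n₀, hn₀⟩ := multiAnchor_loss_pos 1 r c Nat.one_pos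
    refine ⟨max n₀ 1, fun n hn P hP hM => ?_⟩
    have h := hn₀ n (le_trans (le_max_left _ _) hn) P hP
      (mAnchorable_succ (le_trans (le_max_right _ _) hn) hM)
    exact le_trans h (Nat.mul_le_mul_right _ (Nat.pow_le_pow_right (by norm_num) (by omega)))
  · obtain ⟨n₀, hn₀⟩ := multiAnchor_loss_pos m r c hm
    refine ⟨n₀, fun n hn P hP hM => ?_⟩
    exact le_trans (hn₀ n hn P hP hM) (Nat.mul_le_mul_right _ (Nat.pow_le_pow_right (by norm_num) (by omega)))

/-- **PIECE W PROVED: `MultiAnchorLoss3`** (exponent `C = 1`). -/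
theorem multiAnchorLoss3 : MultiAnchorLoss3 := by
  refine ⟨1, fun m r c => ?_⟩
  obtain ⟨n₂, hn₂⟩ := multiAnchor_loss m r c
  refine ⟨max n₂ (max (2 ^ (4 * m + 14)) 3), fun n hn P hP hM => ?_⟩
  have hn2 : n₂ ≤ n := le_trans (le_max_left _ _) hn
  have hKn : 2 ^ (4 * m + 14) ≤ n := le_trans (le_trans (le_max_left _ _) (le_max_right _ _)) hn
  have h3 : 3 ≤ n := le_trans (le_trans (le_max_right _ _) (le_max_right _ _)) hn
  have hL := hn₂ n hn2 P hP hM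
  have hWL := Finset.card_filter_add_card_filter_not
    (s := (univ : Finset (Fin n → Bool)).filter fun x => OddZeros x)
    (fun x => Rel x (fun i => decide (P i x = 1)))
  rw [filter_filter, filter_filter] at hWL
  have hO' := card_odd_le (n := n) h3
  generalize hKc : 2 ^ (4 * m + 14) = Kc at hL hKn
  generalize hW : (univ.filter fun x : Fin n → Bool =>
    OddZeros x ∧ Rel x (fun i => decide (P i x = 1))).card = WIN at hWL ⊢
  generalize hLo : (univ.filter fun x : Fin n → Bool =>
    OddZeros x ∧ ¬ Rel x (fun i => decide (P i x = 1))).card = LOSE at hWL hL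
  generalize hO : (univ.filter fun x : Fin n → Bool => OddZeros x).card = O at hWL hO'
  have hKpos : 0 < Kc := by rw [← hKc]; positivity
  have h1 : Kc * WIN + 2 ^ (n - 1) ≤ Kc * 2 ^ (n - 1) := by
    have e1 : Kc * WIN + Kc * LOSE = Kc * O := by rw [← Nat.mul_add, hWL]
    have e2 := Nat.mul_le_mul_left Kc hO'
    omega
  have h2 : Kc * (n * WIN + 2 ^ (n - 1)) ≤ Kc * (n * 2 ^ (n - 1)) := by
    calc Kc * (n * WIN + 2 ^ (n - 1)) = n * (Kc * WIN) + Kc * 2 ^ (n - 1) := by ring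
      _ ≤ n * (Kc * WIN) + n * 2 ^ (n - 1) := Nat.add_le_add_left (Nat.mul_le_mul_right _ hKn) _
      _ = n * (Kc * WIN + 2 ^ (n - 1)) := by ring
      _ ≤ n * (Kc * 2 ^ (n - 1)) := Nat.mul_le_mul_left _ h1
      _ = Kc * (n * 2 ^ (n - 1)) := by ring
  have hfin : n * WIN + 2 ^ (n - 1) ≤ n * 2 ^ (n - 1) := Nat.le_of_mul_le_mul_left h2 hKpos
  have hreal := real_tail n WIN (2 ^ (n - 1)) (by omega) hfin
  push_cast at hreal
  exact hreal

/-- **NODE COLLAPSE (rev 2)**: with `W` proved the node equation reads `T ⟺ NoMultiAnchorLoss3` — the whole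
special (multi-anchorable) face of the dichotomy is a theorem; what is left of `T` is exactly its restriction to
boundedly-delocalised strategies. -/
theorem polyLossOddU3_iff_noMultiAnchorLoss3 : ExactnessDial.PolyLossOddU3 ↔ NoMultiAnchorLoss3 :=
  ⟨noMultiAnchorLoss3_of_polyLossOddU3, fun h => polyLossOddU3_of_dichotomy multiAnchorLoss3 h⟩

/-- the dial from the residual alone: `NoMultiAnchorLoss3 → DPLift3 → AdviceFreeQNC0Three`. -/
theorem closes_noMultiAnchor (hR : NoMultiAnchorLoss3) (hD : ExactnessDial.DPLift3) : AdviceFreeQNC0Three :=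
  closes_T (polyLossOddU3_of_dichotomy multiAnchorLoss3 hR) hD

end FinalM

end Summit.QuantumAdvantage.QuantumAdvantage.Theorems.AnchorDial

end
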